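import Summits.FinalStateConjecture.FinalStateConjecture.Theses.HarmonicFluxCensus
import Literature.Geometry.Lorentzian.MaximalDataScalarCurvature
import HarnessLib

/-!
# Split of the crux `BoundedCensusGeometry` (route `HarmonicFluxCensus`, stmt-FinalStateConjecture-17468) — crux workfile `Lines/split.lean`

(Strategist copy of the Theorems-side file `HarmonicFluxCensusBoundedCensusGeometrySplit.lean`, attached as evidence on the
item for a prover to land under `Theorems/` — Theorems is prover-only; identical statement and proof, namespace `Cruxes…Split`.)

The crux `G = Theses.HarmonicFluxCensus.BoundedCensusGeometry` (uniform census geometry with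
same-spacetime complete-slice transfer, EXACT count `m`) is implied by three typed pieces, each of a
different kind, none of which is `G` or the summit reworded (cheap probes `Pᵢ → G`, `Pᵢ → S` by
`exact?` / `aesop` / `unfold; simpa` all fail; strategist folder `bc/`):

* **P1 `MaximalLeafDominance`** (dynamical, monotone, committed to census leaves): for every MGHD of
  admissible data there are `(c₁, Q₀)` such that every family of `m` pairwise disjoint compact bodies
  bounded by connected outermost MOTSs (clause C′) on ANY Cauchy slice is DOMINATED (`m ≤ m'`) by such
  a family on a COMPLETE, MAXIMAL (`tr_h k = 0`), VACUUM-CONSTRAINED Cauchy slice of the same spacetime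
  whose common exterior has Neumann–Sobolev constant `≤ c₁` and census functional `≤ Q₀` (the two
  clauses of `SliceCensusInequality` verbatim). Not a consequence of `G` (leaf commitment) and does not
  give `G` (no exact count).
* **P2 `NonnegScalarCensusInequality`** (kinematic): `SliceCensusInequality` restricted to complete data
  sets of NONNEGATIVE SCALAR CURVATURE — the class containing every maximal solution of the vacuum
  constraints, `R_h = |k|²_h ≥ 0` (Isenberg–Mazzeo–Pollack 2003, p. 371; proved in tree:
  `InitialDataSet.IsVacuumConstraintSolution.scalarCurvature_nonneg_of_isMaximalData`). Implied by the
  sibling crux `SliceCensusInequality`; unrelated to `G` alone.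
* **P3 `CheapWitnessPerCount`** (bookkeeping-with-content): `G` with `∃ c₁ Q₀` commuted inside `∀ m` —
  for each count `m` separately, `m` bodies seen on some Cauchy slice are seen on a complete Cauchy slice
  of the same spacetime at SOME finite census cost. A consequence of `G`; does not give `G` (no
  uniformity in `m`).

**Assembly (this file, sorry-free).** `P1 → P2 → P3 → G`: the uniform cost `(c₁, Q₀)` of P1 and the
count `N₀ = N₀(c₁, Q₀)` of P2 — applicable to the maximal vacuum leaves because their scalar curvature
is nonnegative — bound the size of EVERY body family on EVERY Cauchy slice of the development by `N₀`
(domination `m ≤ m' ≤ N₀`); the per-count constants `(c(m), Q(m))` of P3 (extracted by choice) are then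
made uniform as `∑_{n ≤ N₀} max (c n) 0`, `∑_{n ≤ N₀} max (Q n) 0`, and the witness of P3 for the given
`m ≤ N₀` is re-certified at the larger constants by monotonicity of both census clauses
(`ENNReal.ofReal` is monotone, the Sobolev clause is monotone in its multiplicative constant).

Design: the three hypotheses are the piece statements INLINED (their bodies, verbatim the children to be
filed on the route by `route edit --split BoundedCensusGeometry`), so that the route's generated glue item
`MaximalLeafDominance → NonnegScalarCensusInequality → CheapWitnessPerCount → BoundedCensusGeometry`
closes from this theorem by `δ`-unfolding, and no `def` is introduced here. The conclusion is the route
decl BY NAME.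

References: Isenberg–Mazzeo–Pollack, Ann. Henri Poincaré 4 (2003) 369, p. 371 (`R = |Π|² ≥ 0` on
maximal slices) [IsenbergMazzeoPollack2002]; Bartnik, Comm. Math. Phys. 94 (1984) 155 (maximal slices)
[Bartnik1984]; Andersson–Mars–Metzger–Simon 2009 (MOTT propagation) [AnderssonMarsMetzgerSimon2009];
Carron 1999 / Li–Yau 1983 (the counting engine behind P2) [Carron1999] [LiYau1983].
-/

noncomputable section

-- the doubled `FinalStateConjecture` path component is the summit/problem naming scheme
set_option linter.dupNamespace false

open scoped Manifold ContDiff Topology BigOperators ENNReal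
open Set Filter MeasureTheory

namespace Summit.FinalStateConjecture.FinalStateConjecture.Cruxes.BoundedCensusGeometry.Split

open Summit.FinalStateConjecture.FinalStateConjecture.Theses.HarmonicFluxCensus

/-- **Split of `BoundedCensusGeometry`.** `MaximalLeafDominance → NonnegScalarCensusInequality →
CheapWitnessPerCount → BoundedCensusGeometry`, with the three pieces inlined (see the module docstring
for their text and roles). Proof: (1) `(c₁, Q₀)` from piece 1 and `N₀ = N₀(c₁, Q₀)` from piece 2;
(2) every body family on every Cauchy slice has `m ≤ N₀` — dominate it on a complete maximal
vacuum-constrained leaf (piece 1), whose scalar curvature is nonnegative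
(`IsVacuumConstraintSolution.scalarCurvature_nonneg_of_isMaximalData`, Isenberg–Mazzeo–Pollack 2003,
p. 371), and count there (piece 2); (3) choose per-count constants from piece 3 and sum their positive
parts over `m ≤ N₀`; (4) re-certify piece 3's witness at the summed constants by monotonicity.
[cite: IsenbergMazzeoPollack2002, Introduction p. 371] -/
theorem boundedCensusGeometry_of_split :
    (∀ (X : Type) [TopologicalSpace X] [ChartedSpace (EuclideanSpace ℝ (Fin 3)) X] [IsManifold (𝓡 3) ((⊤ : ENat) : WithTop ENat) X] [T2Space X] [SecondCountableTopology X] [ConnectedSpace X] (D : Literature.Geometry.Lorentzian.InitialDataSet (𝓡 3) X), D ∈ Literature.Geometry.Lorentzian.admissibleVacuumData X → ∀ 𝒟 : Literature.Geometry.Lorentzian.VacuumCauchyDevelopment D, 𝒟.IsMaximal → ∃ c₁ Q₀ : ℝ, ∀ (X' : Type) [TopologicalSpace X'] [ChartedSpace (EuclideanSpace ℝ (Fin 3)) X'] [IsManifold (𝓡 3) ((⊤ : ENat) : WithTop ENat) X'] [ConnectedSpace X'] (D' : Literature.Geometry.Lorentzian.InitialDataSet (𝓡 3) X') (𝒟'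 : Literature.Geometry.Lorentzian.CauchyDevelopment D'), 𝒟'.toSpacetime = 𝒟.toSpacetime → ∀ (m : ℕ) (S : Fin m → Literature.Geometry.Lorentzian.OutermostMOTS (𝓡 3) D'.h D'.k), (∀ j, ConnectedSpace (S j).surf) → (∀ j, IsCompact (((S j).exterior : Set X'))ᶜ ∧ (interior (((S j).exterior : Set X'))ᶜ).Nonempty) → Pairwise (fun j j' ↦ Disjoint (((S j).exterior : Set X'))ᶜ (((S j').exterior : Set X'))ᶜ) → ∃ (X'' : Type) (_ : TopologicalSpace X'') (_ : ChartedSpace (EuclideanSpace ℝ (Fin 3)) X'') (_ : IsManifold (𝓡 3) ((⊤ : ENat) : WithTop ENat) X'') (_ : T2Space X'') (_ : LocallyCompactSpace X'') (_ : MeasurableSpace X'') (_ : BorelSpace X'') (_ : ConnectedSpace X'') (D'' : Literature.Geometry.Lorentzian.InitialDataSet (𝓡 3) X'') (𝒟'' : Literature.Geometry.Lorentzian.CauchyDevelopment D'') (_ : D''.metric.HasLeviCivita), 𝒟''.toSpacetime = 𝒟.toSpacetime ∧ D''.IsComplete ∧ D''.IsMaximalData ∧ D''.IsVacuumConstraintSolution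 ∧ ∃ (m' : ℕ) (S'' : Fin m' → Literature.Geometry.Lorentzian.OutermostMOTS (𝓡 3) D''.h D''.k), m ≤ m' ∧ (∀ j, ConnectedSpace (S'' j).surf) ∧ (∀ j, IsCompact (((S'' j).exterior : Set X''))ᶜ ∧ (interior (((S'' j).exterior : Set X''))ᶜ).Nonempty) ∧ Pairwise (fun j j' ↦ Disjoint (((S'' j).exterior : Set X''))ᶜ (((S'' j').exterior : Set X''))ᶜ) ∧ (∀ ζ : X'' → ℝ, ContMDiff (𝓡 3) 𝓘(ℝ, ℝ) 1 ζ → HasCompactSupport ζ → (∫⁻ x in ⋂ j, ((S'' j).exterior : Set X''), ENNReal.ofReal (|ζ x| ^ 6) ∂(Literature.Geometry.Lorentzian.riemannianMeasure D''.h)) ^ (1 / 3 : ℝ) ≤ ENNReal.ofReal c₁ * ∫⁻ x in ⋂ j, ((S'' j).exterior : Set X''), ENNReal.ofReal (D''.metric.innerDual x (mvfderiv (𝓡 3) ζ x).toLinearMap (mvfderiv (𝓡 3) ζ x).toLinearMap) ∂(Literature.Geometry.Lorentzian.riemannianMeasure D''.h)) ∧ (∫⁻ x in ⋂ j, ((S''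 j).exterior : Set X''), ENNReal.ofReal ((D''.metric.normSq x (D''.metric.ricci x)) ^ (3 / 4 : ℝ)) ∂(Literature.Geometry.Lorentzian.riemannianMeasure D''.h)) + ∑ j, (∫⁻ x in Set.range (S'' j).f, ENNReal.ofReal (D''.normSqK x) ∂(Literature.Geometry.Lorentzian.riemannianVolume D''.h 2)) ≤ ENNReal.ofReal Q₀) →
    (∀ c₁ Q₀ : ℝ, ∃ N₀ : ℕ, ∀ (X : Type) [TopologicalSpace X] [ChartedSpace (EuclideanSpace ℝ (Fin 3)) X] [IsManifold (𝓡 3) ((⊤ : ENat) : WithTop ENat) X] [T2Space X] [LocallyCompactSpace X] [MeasurableSpace X] [BorelSpace X] [ConnectedSpace X] (D : Literature.Geometry.Lorentzian.InitialDataSet (𝓡 3) X), (∀ [D.metric.HasLeviCivita], D.IsComplete → (∀ x, 0 ≤ D.metric.scalarCurvature x) → ∀ (m : ℕ) (S : Fin m → Literature.Geometry.Lorentzian.OutermostMOTS (𝓡 3) D.h D.k), (∀ j, ConnectedSpace (S j).surf) → (∀ j, IsCompact (((S j).exterior : Set X))ᶜ ∧ (interior (((S j).exterior : Set X))ᶜ).Nonempty)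 → Pairwise (fun j j' ↦ Disjoint (((S j).exterior : Set X))ᶜ (((S j').exterior : Set X))ᶜ) → (∀ ζ : X → ℝ, ContMDiff (𝓡 3) 𝓘(ℝ, ℝ) 1 ζ → HasCompactSupport ζ → (∫⁻ x in ⋂ j, ((S j).exterior : Set X), ENNReal.ofReal (|ζ x| ^ 6) ∂(Literature.Geometry.Lorentzian.riemannianMeasure D.h)) ^ (1 / 3 : ℝ) ≤ ENNReal.ofReal c₁ * ∫⁻ x in ⋂ j, ((S j).exterior : Set X), ENNReal.ofReal (D.metric.innerDual x (mvfderiv (𝓡 3) ζ x).toLinearMap (mvfderiv (𝓡 3) ζ x).toLinearMap) ∂(Literature.Geometry.Lorentzian.riemannianMeasure D.h)) → (∫⁻ x in ⋂ j, ((S j).exterior : Set X), ENNReal.ofReal ((D.metric.normSq x (D.metric.ricci x)) ^ (3 / 4 : ℝ)) ∂(Literature.Geometry.Lorentzian.riemannianMeasure D.h)) + ∑ j, (∫⁻ x in Set.range (S j).f, ENNReal.ofReal (D.normSqK x) ∂(Literature.Geometry.Lorentzian.riemannianVolume D.h 2)) ≤ ENNReal.ofReal Q₀ → m ≤ N₀))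 →
    (∀ (X : Type) [TopologicalSpace X] [ChartedSpace (EuclideanSpace ℝ (Fin 3)) X] [IsManifold (𝓡 3) ((⊤ : ENat) : WithTop ENat) X] [T2Space X] [SecondCountableTopology X] [ConnectedSpace X] (D : Literature.Geometry.Lorentzian.InitialDataSet (𝓡 3) X), D ∈ Literature.Geometry.Lorentzian.admissibleVacuumData X → ∀ 𝒟 : Literature.Geometry.Lorentzian.VacuumCauchyDevelopment D, 𝒟.IsMaximal → ∀ m : ℕ, ∃ c₁ Q₀ : ℝ, ∀ (X' : Type) [TopologicalSpace X'] [ChartedSpace (EuclideanSpace ℝ (Fin 3)) X'] [IsManifold (𝓡 3) ((⊤ : ENat) : WithTop ENat) X'] [ConnectedSpace X'] (D' : Literature.Geometry.Lorentzian.InitialDataSet (𝓡 3) X') (𝒟' : Literature.Geometry.Lorentzian.CauchyDevelopment D'), 𝒟'.toSpacetime = 𝒟.toSpacetime → ∀ (S : Fin m → Literature.Geometry.Lorentzian.OutermostMOTS (𝓡 3) D'.h D'.k), (∀ j, ConnectedSpace (S j).surf) → (∀ j, IsCompact (((S j).exterior : Set X'))ᶜ ∧ (interior (((S j).exterior : Set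 X'))ᶜ).Nonempty) → Pairwise (fun j j' ↦ Disjoint (((S j).exterior : Set X'))ᶜ (((S j').exterior : Set X'))ᶜ) → ∃ (X'' : Type) (_ : TopologicalSpace X'') (_ : ChartedSpace (EuclideanSpace ℝ (Fin 3)) X'') (_ : IsManifold (𝓡 3) ((⊤ : ENat) : WithTop ENat) X'') (_ : T2Space X'') (_ : LocallyCompactSpace X'') (_ : MeasurableSpace X'') (_ : BorelSpace X'') (_ : ConnectedSpace X'') (D'' : Literature.Geometry.Lorentzian.InitialDataSet (𝓡 3) X'') (𝒟'' : Literature.Geometry.Lorentzian.CauchyDevelopment D'') (_ : D''.metric.HasLeviCivita), 𝒟''.toSpacetime = 𝒟.toSpacetime ∧ D''.IsComplete ∧ ∃ S'' : Fin m → Literature.Geometry.Lorentzian.OutermostMOTS (𝓡 3) D''.h D''.k, (∀ j, ConnectedSpace (S'' j).surf) ∧ (∀ j, IsCompact (((S'' j).exterior : Set X''))ᶜ ∧ (interior (((S'' j).exterior : Set X''))ᶜ).Nonempty) ∧ Pairwise (fun j j' ↦ Disjoint (((S'' j).exterior : Set X''))ᶜ (((S'' j').exterior : Set X''))ᶜ)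 ∧ (∀ ζ : X'' → ℝ, ContMDiff (𝓡 3) 𝓘(ℝ, ℝ) 1 ζ → HasCompactSupport ζ → (∫⁻ x in ⋂ j, ((S'' j).exterior : Set X''), ENNReal.ofReal (|ζ x| ^ 6) ∂(Literature.Geometry.Lorentzian.riemannianMeasure D''.h)) ^ (1 / 3 : ℝ) ≤ ENNReal.ofReal c₁ * ∫⁻ x in ⋂ j, ((S'' j).exterior : Set X''), ENNReal.ofReal (D''.metric.innerDual x (mvfderiv (𝓡 3) ζ x).toLinearMap (mvfderiv (𝓡 3) ζ x).toLinearMap) ∂(Literature.Geometry.Lorentzian.riemannianMeasure D''.h)) ∧ (∫⁻ x in ⋂ j, ((S'' j).exterior : Set X''), ENNReal.ofReal ((D''.metric.normSq x (D''.metric.ricci x)) ^ (3 / 4 : ℝ)) ∂(Literature.Geometry.Lorentzian.riemannianMeasure D''.h)) + ∑ j, (∫⁻ x in Set.range (S'' j).f, ENNReal.ofReal (D''.normSqK x) ∂(Literature.Geometry.Lorentzian.riemannianVolume D''.h 2)) ≤ ENNReal.ofReal Q₀) →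
      BoundedCensusGeometry := by
  intro hDom hIneq hW X _ _ _ _ _ _ D hD 𝒟 hmax
  -- (1) uniform census cost on the maximal leaves, and the kinematic count it buys
  obtain ⟨c₁, Q₀, hdom⟩ := hDom X D hD 𝒟 hmax
  obtain ⟨N₀, hN₀⟩ := hIneq c₁ Q₀
  -- (2) every body family on every Cauchy slice of `𝒟` has at most `N₀` members
  have hbound : ∀ (X' : Type) [TopologicalSpace X'] [ChartedSpace (EuclideanSpace ℝ (Fin 3)) X']
      [IsManifold (𝓡 3) ((⊤ : ENat) : WithTop ENat) X'] [ConnectedSpace X']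
      (D' : Literature.Geometry.Lorentzian.InitialDataSet (𝓡 3) X')
      (𝒟' : Literature.Geometry.Lorentzian.CauchyDevelopment D'), 𝒟'.toSpacetime = 𝒟.toSpacetime →
      ∀ (m : ℕ) (S : Fin m → Literature.Geometry.Lorentzian.OutermostMOTS (𝓡 3) D'.h D'.k),
      (∀ j, ConnectedSpace (S j).surf) →
      (∀ j, IsCompact (((S j).exterior : Set X'))ᶜ ∧ (interior (((S j).exterior : Set X'))ᶜ).Nonempty) →
      Pairwise (fun j j' ↦ Disjoint (((S j).exterior : Set X'))ᶜ (((S j').exterior : Set X'))ᶜ) →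
      m ≤ N₀ := by
    intro X' _ _ _ _ D' 𝒟' h𝒟' m S hS hB hdisj
    obtain ⟨X'', _, _, _, _, _, _, _, _, D'', 𝒟'', _, -, hcomp, hmaxd, hvac, m', S'', hmm', hS'', hB'',
      hdisj'', hsob, hQ⟩ := hdom X' D' 𝒟' h𝒟' m S hS hB hdisj
    have hR : ∀ x, 0 ≤ D''.metric.scalarCurvature x :=
      Literature.Geometry.Lorentzian.InitialDataSet.IsVacuumConstraintSolution.scalarCurvature_nonneg_of_isMaximalData
        hvac hmaxd
    exact hmm'.trans (hN₀ X'' D'' hcomp hR m' S'' hS'' hB'' hdisj'' hsob hQ)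
  -- (3) per-count constants from the pointwise witnesses
  choose c Q hcQ using hW X D hD 𝒟 hmax
  -- (4) uniform constants: sums of positive parts over `m ≤ N₀`
  refine ⟨∑ n ∈ Finset.range (N₀ + 1), max (c n) 0, ∑ n ∈ Finset.range (N₀ + 1), max (Q n) 0, ?_⟩
  intro X' _ _ _ _ D' 𝒟' h𝒟' m S hS hB hdisj
  have hm : m ≤ N₀ := hbound X' D' 𝒟' h𝒟' m S hS hB hdisj
  have hmem : m ∈ Finset.range (N₀ + 1) := Finset.mem_range.mpr (Nat.lt_succ_of_le hm)
  have hc : c m ≤ ∑ n ∈ Finset.range (N₀ + 1), max (c n) 0 :=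
    (le_max_left _ _).trans
      (Finset.single_le_sum (f := fun n ↦ max (c n) 0) (fun n _ ↦ le_max_right _ _) hmem)
  have hQm : Q m ≤ ∑ n ∈ Finset.range (N₀ + 1), max (Q n) 0 :=
    (le_max_left _ _).trans
      (Finset.single_le_sum (f := fun n ↦ max (Q n) 0) (fun n _ ↦ le_max_right _ _) hmem)
  -- (5) the witness for `m`, with its cost relaxed to the uniform constants
  obtain ⟨X'', i₁, i₂, i₃, i₄, i₅, i₆, i₇, i₈, D'', 𝒟'', i₉, hsp, hcomp, S'', hS'', hB'', hdisj'', hsob, hQ''⟩ :=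
    hcQ m X' D' 𝒟' h𝒟' S hS hB hdisj
  refine ⟨X'', i₁, i₂, i₃, i₄, i₅, i₆, i₇, i₈, D'', 𝒟'', i₉, hsp, hcomp, S'', hS'', hB'', hdisj'',
    fun ζ hζ hζc ↦ (hsob ζ hζ hζc).trans ?_, hQ''.trans (ENNReal.ofReal_le_ofReal hQm)⟩
  exact mul_le_mul_left (ENNReal.ofReal_le_ofReal hc) _

end Summit.FinalStateConjecture.FinalStateConjecture.Cruxes.BoundedCensusGeometry.Split

end
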